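import Mathlib
import HarnessLib

/-!
# Dubois' projective metric `δ_C` on complex cones and the contraction principle
# (Dubois 2009; Rugh 2010)

Topic `Literature/Dynamics/Contraction` (Birkhoff–Hopf cone contraction for COMPLEX cones: the tool
behind complex Perron–Frobenius theorems for transfer operators and products of complex matrices).
Mathlib has neither Hilbert's projective metric nor Birkhoff's contraction theorem, let alone the
complex versions (`lean search 'HilbertMetric|projectiveMetric|Birkhoff.*cone|Rugh|Dubois'`:
nothing, 2026-08-15); this file vendors the DEFINITIONS and the printed STATEMENTS (D-0014 named
facts, nothing asserted) of

* L. Dubois, *Projective metrics and contraction principles for complex cones*, J. London Math.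
  Soc. (2) 79 (2009) 719–737 = arXiv:0811.2930 [Dubois2009] — read 2026-08-15 on the held arXiv
  text: Definition 1 (complex cone, proper), Definition 2 (the set `E_C(x,y)` and the gauge
  `δ_C(x,y) = log(b/a)`), Definition 3 (linearly convex, dual complement `C'`), Lemma 2.1 (formula
  (2.9)), Theorem 2.3 (contraction principle), §3 (3.14)–(3.15) (Rugh's cone `ℂⁿ₊` and its
  interior), Theorem 1.1 / Proposition 3.3 (characterisation of the matrices mapping `ℂⁿ₊ ∖ 0` into
  `Int ℂⁿ₊`), Theorem 3.6 (explicit diameter bound `8 log((1+θ)/(1−θ)) + 2 log σ`).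
* H. H. Rugh, *Cones and gauges in complex spaces: spectral gaps and complex Perron–Frobenius
  theory*, Ann. of Math. 171 (2010) 1707–1752 [Rugh2010] — source of `ℂⁿ₊` ((3.14) "Following
  [Rugh07]"); not re-read here, cited through Dubois.

Grounds route CriticalPhenomena/CardyComplexCone (2026-08-15), item
`Summit.CriticalPhenomena.CardyFormulaZ2.Theses.CardyComplexCone.ComplexConeContraction`
(stmt-CriticalPhenomena-8789, "THE ENGINE (Dubois2009 Thm 2.3 + Thm 3.6 + Lemmas 3.1–3.2,
rectangular and sequential reading)") and the planner's definition request D2 `ComplexBirkhoffCone`.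
DELTAS between that item and print, recorded for refuters/provers: (i) Dubois' Prop. 3.3 / Thm 3.6
are stated for SQUARE `n × n` matrices and ONE operator; the item iterates RECTANGULAR matrices
`A_j : ℂ^{n_j} → ℂ^{n_{j+1}}` (Thm 2.3 itself allows `V₁ ≠ V₂`, and `c(TS) ≤ c(T)c(S)`, Remark 1,
gives the sequential form); (ii) print has `σ > 1`, the item `1 ≤ σ`; (iii) the item's conclusion
`|⟨f,x_m⟩⟨g,y_m⟩/(⟨f,y_m⟩⟨g,x_m⟩) − 1| ≤ C r^m` is a DERIVED complex cross-ratio bound (the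
planner's reading of Lemma 3.2's discs inside the annulus `[a,b]`), whereas formula (2.9) controls
`log |cross-ratio|` only.

Rendering notes.
* `δ_C` takes values in `[0, ∞]`; we render it in `EReal` as `ENNReal.log (b / a)` with
  `b = sup |E|`, `a = inf |E|` computed in `ℝ≥0∞` (`b/0 = ∞`, `∞/a = ∞` give `δ = ⊤` exactly in
  the printed infinite cases; for a non-proper cone `E` may be empty and the value is junk), and
  `δ_C(x,y) = 0` when `x, y` are colinear (`¬ LinearIndependent ℂ ![x, y]`).
* "proper: the closure of `C` contains no complex planes" = no `ℂ`-subspace of dimension `2` lies in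
  `closure C` (the remark after Def. 2 uses it exactly so).
* "`V'` its dual" for a complex Banach space = the continuous dual `V →L[ℂ] ℂ`; the duality on `ℂⁿ`
  in §3 is the BILINEAR pairing `⟨x,y⟩ = ∑ x_k y_k` (p. 8).
* Theorem 2.3's "if the diameter `Δ = sup δ_{C₂}(Tx,Ty)` is finite" is rendered as "for every real
  `Δ` bounding all `δ_{C₂}(Tx,Ty)`" (equivalent, `tanh` being monotone and `δ ≥ 0`).
* Not vendored: the spectral-gap assertions (Thm 1.1 second part, Cor. 3.4, Example 1), Lemma 2.2
  (completeness), Prop. 3.5, §§4–5.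

Additions (2026-08-15, definition request `defn-ComplexBirkhoffCone` of route CardyComplexCone, which
asked for this vocabulary under `Literature/Dynamics/TransferOperators`; it lives here):
* topology of `ℂⁿ₊`: `isClosed_rughCone`, `isOpen_rughConeInt`, `rughConeInt_subset_interior`
  (equality (3.15) holds for `n ≥ 2` only: `ℂ¹₊ = ℂ`), `ne_zero_of_mem_rughConeInt`;
* **Lemma 3.2 PROVED**: `duboisCenter`, `duboisRadius` ((3.17)),
  `re_mul_conj_nonpos_iff_mem_closedBall` (condition (3.18) is the closed disc `D̄_kl`, "a brief
  computation"), `duboisE_rughConeInt_eq_iUnion` (`E_{Int ℂⁿ₊}(x,y) = ⋃_{k,l} D̄_kl(x,y)` for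
  `x ∈ Int ℂⁿ₊`, any `y`), `div_mem_duboisE_rughConeInt` (`y_k/x_k ∈ E`);
* named facts `Dubois2009_lemma_3_1` (duality (3.16)) and `Dubois2009_lemma_2_2_1` (aperture:
  `‖αy − x‖ ≤ K δ_C(x,y)`), with Definition 4 `HasBoundedSectionalAperture`.

## References
* [Dubois2009] L. Dubois, J. London Math. Soc. (2) 79 (2009) 719–737 = arXiv:0811.2930, Defs 1–4,
  Lemma 2.1, Lemma 2.2, Thm 2.3 (pp. 4–6), (3.14)–(3.18), Lemmas 3.1–3.2, Prop. 3.3, Thm 3.6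
  (pp. 8–12), Thm 1.1 (p. 2).
* [Rugh2010] H. H. Rugh, Ann. of Math. (2) 171 (2010) 1707–1752 (the cone `ℂⁿ₊`, Lemma 8.2,
  Thm 8.4).
-/

noncomputable section

open scoped ComplexConjugate ENNReal
open Set

namespace Literature.Dynamics.Contraction

section Definitions

variable {V : Type*} [AddCommGroup V] [Module ℂ V]

/-- **Complex cone** (Dubois 2009, Def. 1): a non-empty subset `C ⊆ V` with `ℂ* · C ⊆ C`.
[cite: Dubois2009, Def. 1] -/
def IsComplexCone (C : Set V) : Prop :=
  C.Nonempty ∧ ∀ c : ℂ, c ≠ 0 → ∀ x ∈ C, c • x ∈ C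

/-- **Proper** complex cone (Dubois 2009, Def. 1): a complex cone whose closure contains no
complex plane, i.e. no `ℂ`-subspace of dimension `2`. [cite: Dubois2009, Def. 1] -/
def IsProperComplexCone [TopologicalSpace V] (C : Set V) : Prop :=
  IsComplexCone C ∧ ∀ P : Submodule ℂ V, Module.finrank ℂ P = 2 → ¬ ((P : Set V) ⊆ closure C)

/-- Dubois' set `E_C(x,y) = {z ∈ ℂ : z x − y ∉ C}` (Dubois 2009, Def. 2). [cite: Dubois2009, Def. 2] -/
def duboisE (C : Set V) (x y : V) : Set ℂ :=
  {z : ℂ | z • x - y ∉ C}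

open Classical in
/-- **Dubois' projective gauge** `δ_C(x,y) ∈ [0,∞]` (Dubois 2009, Def. 2), as an extended real:
`0` if `x, y` are colinear, and otherwise `log (b/a)` with `b = sup |E_C(x,y)| ∈ (0,∞]`,
`a = inf |E_C(x,y)| ∈ [0,∞)` (computed in `ℝ≥0∞`, so that `a = 0` or `b = ∞` give `⊤`).
[cite: Dubois2009, Def. 2] -/
def duboisDelta (C : Set V) (x y : V) : EReal :=
  if LinearIndependent ℂ ![x, y] then
    ENNReal.log ((⨆ z ∈ duboisE C x y, (‖z‖₊ : ℝ≥0∞)) / (⨅ z ∈ duboisE C x y, (‖z‖₊ : ℝ≥0∞)))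
  else 0

/-- The **dual complement** `C' = {f ∈ V' : ∀ x ∈ C, ⟨f,x⟩ ≠ 0}` of a complex cone in a complex
normed space, `V'` the continuous dual (Dubois 2009, Def. 3, (2.7)). [cite: Dubois2009, Def. 3, (2.7)] -/
def dualComplement {W : Type*} [NormedAddCommGroup W] [NormedSpace ℂ W] (C : Set W) :
    Set (W →L[ℂ] ℂ) :=
  {f | ∀ x ∈ C, f x ≠ 0}

/-- **Linearly convex** complex cone (Dubois 2009, Def. 3, following Andersson / Hörmander):
through each point of the complement of `C` passes a complex hyperplane (kernel of a continuous
functional) not meeting `C`. [cite: Dubois2009, Def. 3] -/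
def IsLinearlyConvex {W : Type*} [NormedAddCommGroup W] [NormedSpace ℂ W] (C : Set W) : Prop :=
  ∀ x ∉ C, ∃ f : W →L[ℂ] ℂ, f x = 0 ∧ ∀ y ∈ C, f y ≠ 0

/-- **Rugh's canonical complexification of `ℝⁿ₊`** (Dubois 2009, (3.14), following Rugh):
`ℂⁿ₊ = {v ∈ ℂⁿ : ∀ k l, Re(v_k · conj v_l) ≥ 0}`, a closed complex cone.
[cite: Dubois2009, (3.14)] -/
def rughCone (n : ℕ) : Set (Fin n → ℂ) :=
  {v | ∀ k l, 0 ≤ (v k * conj (v l)).re}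

/-- The interior of `ℂⁿ₊` as printed (Dubois 2009, (3.15)):
`Int ℂⁿ₊ = {v ∈ ℂⁿ : ∀ k l, Re(v_k · conj v_l) > 0}`. [cite: Dubois2009, (3.15)] -/
def rughConeInt (n : ℕ) : Set (Fin n → ℂ) :=
  {v | ∀ k l, 0 < (v k * conj (v l)).re}

/-- The bilinear duality `⟨x,y⟩ = ∑ x_k y_k` on `ℂⁿ` used in Dubois 2009, §3 (p. 8).
[cite: Dubois2009, §3 (p. 8)] -/
def bilinPairing {n : ℕ} (x y : Fin n → ℂ) : ℂ :=
  ∑ k, x k * y k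

end Definitions

/-! ### Named facts (nothing asserted) -/

/-- **Dubois 2009, Lemma 2.1** (formula (2.9)): for a linearly convex proper complex cone `C` in a
complex Banach space, `δ_C` is a projective metric on `C` and
`δ_C(x,y) = sup_{f,g ∈ C'} log |⟨f,y⟩⟨g,x⟩ / (⟨f,x⟩⟨g,y⟩)|` for `x, y ∈ C`
(only the formula is rendered). The hypothesis `C ≠ V` is the paper's standing non-degeneracy
remark (p. 5: "if `C` is linearly convex and `C ≠ V`, then `0 ∉ C`, `0 ∉ C'`"), without which the
dual complement is empty and (2.9) is void (e.g. `V = ℂ`, `C = ℂ`, which is vacuously proper and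
linearly convex). Users take `(h : Dubois2009_lemma_2_1)`. [cite: Dubois2009, Lemma 2.1, (2.9), p. 5] -/
def Dubois2009_lemma_2_1 : Prop :=
  ∀ {V : Type} [NormedAddCommGroup V] [NormedSpace ℂ V] [CompleteSpace V] (C : Set V),
    IsProperComplexCone C → IsLinearlyConvex C → C ≠ Set.univ →
      ∀ x ∈ C, ∀ y ∈ C,
        duboisDelta C x y =
          ⨆ f ∈ dualComplement C, ⨆ g ∈ dualComplement C,
            ((Real.log ‖f y * g x / (f x * g y)‖ : ℝ) : EReal)

/-- **Dubois 2009, Theorem 2.3 (contraction principle).** Let `V₁, V₂` be complex Banach spaces,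
`C₁ ⊆ V₁`, `C₂ ⊆ V₂` proper complex cones (not necessarily linearly convex), `T : V₁ → V₂` linear
with `T(C₁ ∖ 0) ⊆ C₂ ∖ 0`. If the diameter `Δ = sup_{x,y ∈ C₁∖0} δ_{C₂}(Tx,Ty)` is finite then
`δ_{C₂}(Tx,Ty) ≤ tanh(Δ/4) · δ_{C₁}(x,y)` for all `x, y ∈ C₁` (rendered for nonzero `x, y` and for
any real upper bound `Δ` of the diameter). Users take `(h : Dubois2009_thm_2_3)`.
[cite: Dubois2009, Thm 2.3] -/
def Dubois2009_thm_2_3 : Prop :=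
  ∀ {V₁ V₂ : Type} [NormedAddCommGroup V₁] [NormedSpace ℂ V₁] [CompleteSpace V₁]
    [NormedAddCommGroup V₂] [NormedSpace ℂ V₂] [CompleteSpace V₂] (C₁ : Set V₁) (C₂ : Set V₂),
    IsProperComplexCone C₁ → IsProperComplexCone C₂ →
      ∀ (T : V₁ →ₗ[ℂ] V₂), (∀ x ∈ C₁, x ≠ 0 → T x ∈ C₂ ∧ T x ≠ 0) →
        ∀ Δ : ℝ, (∀ x ∈ C₁, x ≠ 0 → ∀ y ∈ C₁, y ≠ 0 → duboisDelta C₂ (T x) (T y) ≤ (Δ : EReal)) →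
          ∀ x ∈ C₁, x ≠ 0 → ∀ y ∈ C₁, y ≠ 0 →
            duboisDelta C₂ (T x) (T y) ≤ ((Real.tanh (Δ / 4) : ℝ) : EReal) * duboisDelta C₁ x y

/-- **Dubois 2009, Theorem 1.1 (first assertion) = Proposition 3.3**: a complex `n × n` matrix `A`
maps `ℂⁿ₊ ∖ 0` into `Int ℂⁿ₊` if and only if for all indices `k, l, p, q`,
`Re(conj(a_kp) a_lq + conj(a_kq) a_lp) > |a_kp a_lq − a_kq a_lp|`. Users take
`(h : Dubois2009_thm_1_1_iff)`. [cite: Dubois2009, Thm 1.1, Prop. 3.3, (3.19)–(3.20)] -/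
def Dubois2009_thm_1_1_iff : Prop :=
  ∀ (n : ℕ) (A : Matrix (Fin n) (Fin n) ℂ),
    (∀ v ∈ rughCone n, v ≠ 0 → A.mulVec v ∈ rughConeInt n) ↔
      ∀ k l p q, ‖A k p * A l q - A k q * A l p‖ < (conj (A k p) * A l q + conj (A k q) * A l p).re

/-- **Dubois 2009, Theorem 3.6** (= Theorem 1.1, last assertion): let `θ ∈ (0,1)`, `σ > 1`, and let
the complex `n × n` matrix `A` satisfy, for all indices `k, l, p, q`,
`Re(conj(a_kp) a_lq + conj(a_kq) a_lp) > θ⁻¹ |a_kp a_lq − a_kq a_lp|` and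
`|a_kp a_lq| ≤ σ² |a_kq a_lp|`. Then `A(ℂⁿ₊ ∖ 0) ⊆ Int ℂⁿ₊` and the `δ`-diameter of `A(ℂⁿ₊ ∖ 0)`
(with respect to `δ_{ℂⁿ₊}`, Thm 1.1) is at most `8 log((1+θ)/(1−θ)) + 2 log σ`. Users take
`(h : Dubois2009_thm_3_6)`. [cite: Dubois2009, Thm 3.6; Thm 1.1] -/
def Dubois2009_thm_3_6 : Prop :=
  ∀ (n : ℕ) (θ σ : ℝ), 0 < θ → θ < 1 → 1 < σ → ∀ (A : Matrix (Fin n) (Fin n) ℂ),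
    (∀ k l p q, θ⁻¹ * ‖A k p * A l q - A k q * A l p‖ < (conj (A k p) * A l q + conj (A k q) * A l p).re ∧
        ‖A k p * A l q‖ ≤ σ ^ 2 * ‖A k q * A l p‖) →
      (∀ v ∈ rughCone n, v ≠ 0 → A.mulVec v ∈ rughConeInt n) ∧
        ∀ x ∈ rughCone n, x ≠ 0 → ∀ y ∈ rughCone n, y ≠ 0 →
          duboisDelta (rughCone n) (A.mulVec x) (A.mulVec y) ≤
            ((8 * Real.log ((1 + θ) / (1 - θ)) + 2 * Real.log σ : ℝ) : EReal)

/-! ### Sanity checks on the definitions (consequences of the defs only) -/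

/-- `ℂⁿ₊` contains the positive orthant vectors with a common phase, e.g. the constant vector `1`.
[cite: Dubois2009, (3.14)] -/
theorem one_mem_rughConeInt (n : ℕ) : (fun _ : Fin n => (1 : ℂ)) ∈ rughConeInt n := by
  intro k l
  simp

/-- `Int ℂⁿ₊ ⊆ ℂⁿ₊`. [cite: Dubois2009, (3.14)–(3.15)] -/
theorem rughConeInt_subset (n : ℕ) : rughConeInt n ⊆ rughCone n :=
  fun _ hv k l => (hv k l).le

/-- `ℂⁿ₊` is stable under `ℂ*` (indeed under all of `ℂ`): it is a complex cone in the sense of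
Def. 1. [cite: Dubois2009, Def. 1, (3.14)] -/
theorem isComplexCone_rughCone (n : ℕ) : IsComplexCone (rughCone n) := by
  refine ⟨⟨0, fun k l => by simp⟩, fun c _ v hv k l => ?_⟩
  have h : (c • v) k * conj ((c • v) l) = (c * conj c) * (v k * conj (v l)) := by
    simp only [Pi.smul_apply, smul_eq_mul, map_mul]
    ring
  rw [h, Complex.mul_conj, Complex.re_ofReal_mul]
  exact mul_nonneg (Complex.normSq_nonneg c) (hv k l)

/-- The gauge vanishes on colinear pairs (Def. 2, first clause). [cite: Dubois2009, Def. 2] -/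
theorem duboisDelta_self {V : Type*} [AddCommGroup V] [Module ℂ V] (C : Set V) (x : V) :
    duboisDelta C x x = 0 := by
  classical
  unfold duboisDelta
  rw [if_neg]
  intro h
  have := h.injective (a₁ := 0) (a₂ := 1) (by simp)
  exact absurd this (by decide)

/-! ### Additions (2026-08-15, definition request `defn-ComplexBirkhoffCone`): topology of `ℂⁿ₊`,
Dubois' Lemma 3.2 (the set `E` for `Int ℂⁿ₊` is a union of closed discs, PROVED), Lemma 3.1
(duality, named fact), Definition 4 and Lemma 2.2 (1) (bounded sectional aperture, named fact) -/

section Topology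

/-- `ℂⁿ₊` is closed ((3.14): "a closed complex cone"). [cite: Dubois2009, (3.14)] -/
theorem isClosed_rughCone (n : ℕ) : IsClosed (rughCone n) := by
  have : rughCone n = ⋂ k, ⋂ l, {v : Fin n → ℂ | 0 ≤ (v k * conj (v l)).re} := by
    ext v; simp [rughCone]
  rw [this]
  exact isClosed_iInter fun k => isClosed_iInter fun l =>
    isClosed_le continuous_const (by fun_prop)

/-- The printed interior `{v : ∀ k l, Re(v_k conj v_l) > 0}` is an open set. [cite: Dubois2009, (3.15)] -/
theorem isOpen_rughConeInt (n : ℕ) : IsOpen (rughConeInt n) := by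
  have : rughConeInt n = ⋂ k, ⋂ l, {v : Fin n → ℂ | 0 < (v k * conj (v l)).re} := by
    ext v; simp [rughConeInt]
  rw [this]
  exact isOpen_iInter_of_finite fun k => isOpen_iInter_of_finite fun l =>
    isOpen_lt continuous_const (by fun_prop)

/-- Hence the printed interior is contained in the topological interior of `ℂⁿ₊`. (Equality, the
content of (3.15), holds for `n ≥ 2`; for `n = 1`, `ℂ¹₊ = ℂ` while the printed set is `ℂ ∖ {0}`.)
[cite: Dubois2009, (3.15)] -/
theorem rughConeInt_subset_interior (n : ℕ) : rughConeInt n ⊆ interior (rughCone n) :=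
  interior_maximal (rughConeInt_subset n) (isOpen_rughConeInt n)

/-- A vector of the printed interior has no zero coordinate. [cite: Dubois2009, (3.15)] -/
theorem ne_zero_of_mem_rughConeInt {n : ℕ} {v : Fin n → ℂ} (hv : v ∈ rughConeInt n) (k : Fin n) :
    v k ≠ 0 := fun h => by
  have := hv k k
  rw [h, zero_mul, Complex.zero_re] at this
  exact lt_irrefl 0 this

end Topology

/-! ### Dubois' Lemma 3.2: `E_{Int ℂⁿ₊}(x, y)` is a finite union of closed discs -/

section Discs

/-- The centre `c_kl(x,y) = (conj(x_l) y_k + conj(x_k) y_l) / (2 Re(x_k conj x_l))` of Dubois'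
disc `D̄_kl(x,y)`. [cite: Dubois2009, Lemma 3.2, (3.17)] -/
def duboisCenter {n : ℕ} (x y : Fin n → ℂ) (k l : Fin n) : ℂ :=
  (conj (x l) * y k + conj (x k) * y l) / ((2 * (x k * conj (x l)).re : ℝ) : ℂ)

/-- The radius `r_kl(x,y) = |x_l y_k − x_k y_l| / (2 Re(x_k conj x_l))` of Dubois' disc `D̄_kl(x,y)`.
[cite: Dubois2009, Lemma 3.2, (3.17)] -/
def duboisRadius {n : ℕ} (x y : Fin n → ℂ) (k l : Fin n) : ℝ :=
  ‖x l * y k - x k * y l‖ / (2 * (x k * conj (x l)).re)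

/-- The algebra behind Lemma 3.2: for `α = Re(x_k conj x_l) > 0`, condition (3.18)
`Re((z x_l − y_l) · conj(z x_k − y_k)) ≤ 0` says exactly that `z` lies in the closed disc of
centre `c_kl` and radius `r_kl` ("a brief computation", Dubois 2009, proof of Lemma 3.2).
[cite: Dubois2009, Lemma 3.2 (proof, (3.18))] -/
theorem re_mul_conj_nonpos_iff_mem_closedBall {n : ℕ} (x y : Fin n → ℂ) (k l : Fin n)
    (hα : 0 < (x k * conj (x l)).re) (z : ℂ) :
    ((z * x l - y l) * conj (z * x k - y k)).re ≤ 0 ↔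
      z ∈ Metric.closedBall (duboisCenter x y k l) (duboisRadius x y k l) := by
  set α : ℝ := (x k * conj (x l)).re with hαdef
  have h2α : (0 : ℝ) < 2 * α := by linarith
  -- clear the (real, positive) denominator of the centre
  have hcen : ∀ w : ℂ, Complex.normSq (z - w / ((2 * α : ℝ) : ℂ)) =
      Complex.normSq (z * ((2 * α : ℝ) : ℂ) - w) / (2 * α) ^ 2 := by
    intro w
    have hne : ((2 * α : ℝ) : ℂ) ≠ 0 := by exact_mod_cast h2α.ne'
    rw [show z - w / ((2 * α : ℝ) : ℂ) = (z * ((2 * α : ℝ) : ℂ) - w) / ((2 * α : ℝ) : ℂ) by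
      field_simp, Complex.normSq_div, Complex.normSq_ofReal]
    ring
  -- the key polynomial identity
  have key : Complex.normSq (z * ((2 * α : ℝ) : ℂ) - (conj (x l) * y k + conj (x k) * y l)) -
      Complex.normSq (x l * y k - x k * y l) = 4 * α * ((z * x l - y l) * conj (z * x k - y k)).re := by
    simp only [hαdef, Complex.normSq_apply, Complex.mul_re, Complex.mul_im, Complex.sub_re,
      Complex.sub_im, Complex.add_re, Complex.add_im, Complex.conj_re, Complex.conj_im,
      Complex.ofReal_re, Complex.ofReal_im]
    ring
  rw [Metric.mem_closedBall, dist_eq_norm]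
  have hr : 0 ≤ duboisRadius x y k l := by
    rw [duboisRadius, ← hαdef]
    exact div_nonneg (norm_nonneg _) h2α.le
  have hnorm : ‖z - duboisCenter x y k l‖ ^ 2 =
      Complex.normSq (z * ((2 * α : ℝ) : ℂ) - (conj (x l) * y k + conj (x k) * y l)) / (2 * α) ^ 2 := by
    rw [← Complex.normSq_eq_norm_sq, duboisCenter, ← hαdef]
    exact hcen _
  have hrad : duboisRadius x y k l ^ 2 = Complex.normSq (x l * y k - x k * y l) / (2 * α) ^ 2 := by
    rw [duboisRadius, ← hαdef, div_pow, ← Complex.normSq_eq_norm_sq]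
  have hpos : (0 : ℝ) < (2 * α) ^ 2 := by positivity
  constructor
  · intro hQ
    have hsq : ‖z - duboisCenter x y k l‖ ^ 2 ≤ duboisRadius x y k l ^ 2 := by
      rw [hnorm, hrad, div_le_div_iff_of_pos_right hpos]
      nlinarith [key, hQ, hα]
    exact (pow_le_pow_iff_left₀ (norm_nonneg _) hr two_ne_zero).1 hsq
  · intro h
    have hsq : ‖z - duboisCenter x y k l‖ ^ 2 ≤ duboisRadius x y k l ^ 2 :=
      pow_le_pow_left₀ (norm_nonneg _) h 2
    rw [hnorm, hrad, div_le_div_iff_of_pos_right hpos] at hsq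
    nlinarith [key, hsq, hα]

/-- **Dubois 2009, Lemma 3.2** (PROVED): for `x ∈ Int ℂⁿ₊` (printed for `x, y ∈ Int ℂⁿ₊`; `y` may
in fact be arbitrary) the set `E_{Int ℂⁿ₊}(x, y) = {z : z x − y ∉ Int ℂⁿ₊}` is the union over all
pairs `k, l` of the closed discs `D̄_kl(x,y)` of centre `c_kl(x,y)` and radius `r_kl(x,y)` given by
(3.17) (`duboisCenter`, `duboisRadius`; for `k = l`, or whenever `x_l y_k = x_k y_l`, the disc is the
point `y_k / x_k`). [cite: Dubois2009, Lemma 3.2, (3.17)–(3.18)] -/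
theorem duboisE_rughConeInt_eq_iUnion {n : ℕ} {x : Fin n → ℂ} (hx : x ∈ rughConeInt n)
    (y : Fin n → ℂ) :
    duboisE (rughConeInt n) x y =
      ⋃ k, ⋃ l, Metric.closedBall (duboisCenter x y k l) (duboisRadius x y k l) := by
  -- `Re(a conj b) = Re(b conj a)` (the tree has this as `…Halasz.Restricted.re_mul_conj_comm`; restated
  -- locally to keep the imports as they are)
  have hcomm : ∀ a b : ℂ, (a * conj b).re = (b * conj a).re := fun a b => by
    simp only [Complex.mul_re, Complex.conj_re, Complex.conj_im]
    ring
  ext z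
  simp only [duboisE, rughConeInt, mem_setOf_eq, not_forall, not_lt, mem_iUnion, Pi.sub_apply,
    Pi.smul_apply, smul_eq_mul]
  constructor
  · rintro ⟨k, l, hkl⟩
    refine ⟨k, l, (re_mul_conj_nonpos_iff_mem_closedBall x y k l (hx k l) z).1 ?_⟩
    rwa [hcomm]
  · rintro ⟨k, l, hkl⟩
    refine ⟨k, l, ?_⟩
    rw [hcomm]
    exact (re_mul_conj_nonpos_iff_mem_closedBall x y k l (hx k l) z).2 hkl

/-- In particular every quotient `y_k / x_k` lies in `E_{Int ℂⁿ₊}(x, y)` (the degenerate disc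
`D̄_kk`): `(y_k/x_k) x − y` has a vanishing `k`-th coordinate. [cite: Dubois2009, Lemma 3.2] -/
theorem div_mem_duboisE_rughConeInt {n : ℕ} {x : Fin n → ℂ} (hx : x ∈ rughConeInt n)
    (y : Fin n → ℂ) (k : Fin n) : y k / x k ∈ duboisE (rughConeInt n) x y := by
  simp only [duboisE, rughConeInt, mem_setOf_eq, not_forall, not_lt]
  refine ⟨k, k, ?_⟩
  have hxk : x k ≠ 0 := ne_zero_of_mem_rughConeInt hx k
  simp [div_mul_cancel₀ _ hxk]

end Discs

/-! ### Dubois' Lemma 3.1 (duality) and Lemma 2.2 (1) (aperture) as named facts -/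

section MoreFacts

/-- **Dubois 2009, Lemma 3.1** (linear convexity of `ℂⁿ₊ ∖ {0}` and of `Int ℂⁿ₊`; duality through the
bilinear pairing `⟨x, y⟩ = Σ x_k y_k`, (3.16)): `x ∈ Int ℂⁿ₊ ⟺ ⟨y, x⟩ ≠ 0` for all
`y ∈ ℂⁿ₊ ∖ {0}`, and `y ∈ ℂⁿ₊ ∖ {0} ⟺ ⟨y, x⟩ ≠ 0` for all `x ∈ Int ℂⁿ₊` (with `Int ℂⁿ₊` the
printed set (3.15), `rughConeInt`). Users take `(h : Dubois2009_lemma_3_1)`.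
[cite: Dubois2009, Lemma 3.1, (3.16)] -/
def Dubois2009_lemma_3_1 : Prop :=
  ∀ n : ℕ,
    (∀ x : Fin n → ℂ, x ∈ rughConeInt n ↔ ∀ y ∈ rughCone n, y ≠ 0 → bilinPairing y x ≠ 0) ∧
      ∀ y : Fin n → ℂ, (y ∈ rughCone n ∧ y ≠ 0) ↔ ∀ x ∈ rughConeInt n, bilinPairing y x ≠ 0

/-- **`K`-bounded sectional aperture** (Dubois 2009, Def. 4, following Rugh): for each complex
2-dimensional subspace `P` there is a nonzero continuous functional `m = m_P` with
`‖m‖ ‖u‖ ≤ K |⟨m, u⟩|` for all `u ∈ C ∩ P` (`K ≥ 1`). In finite dimension every proper complex cone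
has bounded sectional aperture for some `K` (Rugh, Lemma 8.2; not vendored).
[cite: Dubois2009, Def. 4, (2.10)] -/
def HasBoundedSectionalAperture {W : Type*} [NormedAddCommGroup W] [NormedSpace ℂ W] (K : ℝ)
    (C : Set W) : Prop :=
  ∀ P : Submodule ℂ W, Module.finrank ℂ P = 2 →
    ∃ m : W →L[ℂ] ℂ, m ≠ 0 ∧ ∀ u ∈ C ∩ (P : Set W), ‖m‖ * ‖u‖ ≤ K * ‖m u‖

/-- **Dubois 2009, Lemma 2.2 (1)** (the gauge controls the norm distance up to a phase): let `C` be
a proper complex cone of `K`-bounded sectional aperture (`K ≥ 1`) in a complex Banach space; for any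
`x, y ∈ C` with `‖x‖ = ‖y‖ = 1` there exists `α ∈ ℂ`, `|α| = 1`, with `‖α y − x‖ ≤ K δ_C(x, y)`
(in `[0, ∞]`). Users take `(h : Dubois2009_lemma_2_2_1)`. [cite: Dubois2009, Lemma 2.2 (1)] -/
def Dubois2009_lemma_2_2_1 : Prop :=
  ∀ {V : Type} [NormedAddCommGroup V] [NormedSpace ℂ V] [CompleteSpace V] (C : Set V) (K : ℝ),
    1 ≤ K → IsProperComplexCone C → HasBoundedSectionalAperture K C →
      ∀ x ∈ C, ∀ y ∈ C, ‖x‖ = 1 → ‖y‖ = 1 →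
        ∃ α : ℂ, ‖α‖ = 1 ∧ ((‖α • y - x‖ : ℝ) : EReal) ≤ (K : EReal) * duboisDelta C x y

end MoreFacts

end Literature.Dynamics.Contraction

end
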